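/- Copyright: ym3-torus cell, WIDTH-5 ATTACH seat `ym-ust-19936-w4` (prover, g10), for crux `HistoryTailL` (stmt-QuantumFields-19936),
level-0 prefactor-free infrastructure (assembly) of LINE `local_insertion` (#13) ∕ K1.  Released under the licence of the surrounding project. -/
import Summits.QuantumFields.YangMills.Theorems.LocalInsertionExpMomentSU2TorusOfLowerBound
import Summits.QuantumFields.YangMills.Theorems.LocalInsertionTorusTreeGaugeGaussian
import HarnessLib

/-!
# The prefactor-free single-plaquette exponential moment of `SU(2)` on the three-torus (EM): the assembled sandwich

Support file (`--supports stmt-QuantumFields-19936 --as helper`): the ASSEMBLY of the cell's level-0 PREFACTOR-FREE plan (memo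
`PREFACTOR-FREE-LEVEL0-w7g9.md`; LEAD ★w1-19936 g7 00:09:18Z split, 00:19:25Z ∕ 00:23:09Z «assembly pen = whoever is free, MINE-first»;
★w7-19936 g9 00:23:53Z «ASSEMBLY: YOURS»).  Inputs, all landed: the chessboard door ✓`WilsonPlaquetteExpMomentSandwich` (★w7), the
triangular UPPER bound ✓`LocalInsertionTriangularHaarIntegration` ∕ ✓`…TriangularPlaquetteBound` ∕ ✓`…OneLinkGaussianBoundSU2` and the
skeleton ✓`…ExpMomentSU2TorusOfLowerBound` (this seat), the tree-gauge LOWER bound ✓`LocalInsertionTorusTreeGaugeLowerBound` ∕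
✓`…TorusTreeGaugeGaussian` (★w7, `exists_lintegral_boltzmann_ge_treeGauge_SU`).

THE THEOREM (EM).  There is an absolute constant `C` (`= 2048·e^{144}∕c³`, `c` the `SU(2)` Haar small-ball constant) such that for
every EVEN `n ≥ 2`, every `0 ≤ λ < 1` and `β` with `(1−λ)β ≥ 1`, every plaquette `(c₀; 0, a)` of `(ℤ∕nℤ)³`:

  `∫ exp(λβ·(2 − Re tr U_{(c₀;0,a)})) dμ_{Λ,β} ≤ C · (1−λ)^{−3} · β^{3(n²+n+1)∕(2n³)}`        (`exists_integral_exp_mul_plaquette_su2_le`)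

and the Chernoff tail `μ_{Λ,β}{θ ≤ ‖U_p − 1‖} ≤ C·(1−λ)^{−3}·β^{3(n²+n+1)∕(2n³)}·e^{−λβθ²∕2}` (`exists_measureReal_largePlaquette_su2_le`);
`3(n²+n+1)∕(2n³) ≤ 9∕(2n)` (`exponent_le`).  Versus the tree's ✓`T3FinestHeightTail.gibbsMeasure_real_dist1_ge_le` (`(√β)⁹·e^{−βθ²∕4}`) the
volume-entropy power `(√β)⁹` has become `β^{O(1∕n)}`: the Gaussian exponents of the two halves of the sandwich are both SHARP
(`3∕2` per free link: `2n³+1` below, `2n³−n²−n` above) and only the defect `n² + n + 1` survives the `n³`-th root.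

HONEST SCOPE ∕ CAVEAT (LEAD ★w1-19936 g7 00:00:53Z, carried verbatim).  (EM) is a statement about ONE bare plaquette of the `SU(2)` Wilson
measure on `(ℤ∕nℤ)³` at coupling `β`, with `n, β, λ` DISPLAYED.  Its residual `β^{3(n²+n+1)∕(2n³)}` is NOT γ-uniform at fixed small `K`
along the `T3Family` towers (`log β_K ∕ n_K ∋ log γ⁻¹∕(2L^{m+K})`), so (EM) meets `stub_insertionHeightOne`'s «∃ M₀ before ∃ γ₁ ∀ γ ≤ γ₁ ∀ K»
only for `K ≥ K_*(L, γ)` or with `M₀` depending on `γ` — it is NOT that stub and must never be worded as it; the γ-uniform cure is the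
holonomy-conditioned doubling (T4, ★w7's road, d = 4 precedent ✓`LangevinControlUVFemtoCurvatureTwoPointCUniformDoublingAll`).  Nothing
of heights `j ≥ 1`, of LINE #13's stubs, of `HistoryTailL` or of any crux is proved.  YM₃ on T³ is rung R3 — not d = 4, not infinite volume,
not a mass gap, not Clay.
-/

namespace Summit.QuantumFields.YangMills.Theorems.LocalInsertion.ExpMomentSU2

open MeasureTheory Real
open scoped Matrix.Norms.L2Operator ENNReal
open Literature.MathematicalPhysics.QuantumFieldTheory
open Literature.MathematicalPhysics.QuantumLattice (fundamentalRep)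
open Summit.QuantumFields.YangMills.Theorems.LocalInsertion.TorusTreeGauge (exists_lintegral_boltzmann_ge_treeGauge_SU)

noncomputable section

/-! ## §1 Exponent bookkeeping -/

/-- **THE EXPONENT BOOKKEEPING OF THE SANDWICH (logarithmic form).**  With `zup = (8∕(β′√β′))^{2n³−n²−n}`, `β′ = (1−λ)β ≥ 1`,
and `zlow = e^{−144n³}·(c·(1+β)^{−3∕2})^{2n³+1}` (`0 < c ≤ 1`):
`n^{−3}·(log zup − log zlow) ≤ log(2048·e^{144}∕c³) + 3·log((1−λ)⁻¹) + (3(n²+n+1)∕(2n³))·log β`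
(`#E_free − #private = n² + n + 1` carries the whole `β`-dependence; `1 + β ≤ 2β`). [folklore] -/
theorem sandwich_log_le {n : ℕ} (hn : 1 ≤ n) {c lam β : ℝ} (hc0 : 0 < c) (hc1 : c ≤ 1) (hlam0 : 0 ≤ lam)
    (hlam1 : lam < 1) (hβ : 1 ≤ (1 - lam) * β) :
    (1 / (n : ℝ) ^ 3) *
        (Real.log ((8 / (((1 - lam) * β) * Real.sqrt ((1 - lam) * β))) ^ (2 * n ^ 3 - n ^ 2 - n)) -
          Real.log (Real.exp (-(8 * (2 : ℝ) * 3 ^ 2 * (n : ℝ) ^ 3)) *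
            (c * (Real.sqrt (1 + β))⁻¹ ^ 3) ^ (2 * n ^ 3 + 1))) ≤
      Real.log (2048 * Real.exp 144 / c ^ 3) + 3 * Real.log ((1 - lam)⁻¹) +
        (3 * ((n : ℝ) ^ 2 + n + 1) / (2 * (n : ℝ) ^ 3)) * Real.log β := by
  have hn0 : (0 : ℝ) < n := by exact_mod_cast hn
  have hn3 : (0 : ℝ) < (n : ℝ) ^ 3 := by positivity
  have h1l : 0 < 1 - lam := by linarith
  have hβ' : 1 ≤ (1 - lam) * β := hβ
  have hβ'0 : 0 < (1 - lam) * β := by linarith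
  have hβ0 : 0 < β := (mul_pos_iff_of_pos_left h1l).1 (by linarith)
  have hβ1 : 1 ≤ β := by
    have : (1 - lam) * β ≤ 1 * β := mul_le_mul_of_nonneg_right (by linarith) hβ0.le
    linarith
  -- the casts of the exponents
  have hsub : n ^ 2 + n ≤ 2 * n ^ 3 := by
    have h2 : n ^ 2 ≤ n ^ 3 := Nat.pow_le_pow_right hn (by norm_num)
    have h1 : n ^ 1 ≤ n ^ 3 := Nat.pow_le_pow_right hn (by norm_num)
    rw [pow_one] at h1
    omega
  have ha : ((2 * n ^ 3 - n ^ 2 - n : ℕ) : ℝ) = 2 * (n : ℝ) ^ 3 - (n : ℝ) ^ 2 - n := by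
    rw [Nat.sub_sub, Nat.cast_sub hsub]
    push_cast
    ring
  have hb : ((2 * n ^ 3 + 1 : ℕ) : ℝ) = 2 * (n : ℝ) ^ 3 + 1 := by push_cast; ring
  -- the logarithms
  have hsq : 0 < Real.sqrt ((1 - lam) * β) := Real.sqrt_pos.2 hβ'0
  have hsq1 : 0 < Real.sqrt (1 + β) := Real.sqrt_pos.2 (by linarith)
  have hlog_up : Real.log ((8 / (((1 - lam) * β) * Real.sqrt ((1 - lam) * β))) ^ (2 * n ^ 3 - n ^ 2 - n)) =
      (2 * (n : ℝ) ^ 3 - (n : ℝ) ^ 2 - n) *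
        (3 * Real.log 2 - (3 / 2) * (Real.log (1 - lam) + Real.log β)) := by
    rw [Real.log_pow, ha, Real.log_div (by norm_num) (by positivity), Real.log_mul hβ'0.ne' hsq.ne',
      Real.log_sqrt hβ'0.le, Real.log_mul h1l.ne' hβ0.ne', show (8 : ℝ) = 2 ^ 3 by norm_num, Real.log_pow]
    push_cast
    ring
  have hlog_low : Real.log (Real.exp (-(8 * (2 : ℝ) * 3 ^ 2 * (n : ℝ) ^ 3)) *
      (c * (Real.sqrt (1 + β))⁻¹ ^ 3) ^ (2 * n ^ 3 + 1)) =
      -(144 * (n : ℝ) ^ 3) + (2 * (n : ℝ) ^ 3 + 1) * (Real.log c - (3 / 2) * Real.log (1 + β)) := by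
    rw [Real.log_mul (Real.exp_pos _).ne' (by positivity), Real.log_exp, Real.log_pow, hb,
      Real.log_mul hc0.ne' (by positivity), Real.log_pow, Real.log_inv, Real.log_sqrt (by linarith)]
    push_cast
    ring
  have hlog_K : Real.log (2048 * Real.exp 144 / c ^ 3) = 11 * Real.log 2 + 144 - 3 * Real.log c := by
    rw [Real.log_div (by positivity) (by positivity), Real.log_mul (by norm_num) (Real.exp_pos _).ne', Real.log_exp,
      show (2048 : ℝ) = 2 ^ 11 by norm_num, Real.log_pow, Real.log_pow]
    push_cast
    ring
  rw [hlog_up, hlog_low, hlog_K, Real.log_inv]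
  -- sign facts
  have hl2 : 0 ≤ Real.log 2 := Real.log_nonneg (by norm_num)
  have hlβ : 0 ≤ Real.log β := Real.log_nonneg hβ1
  have hl1β : Real.log (1 + β) ≤ Real.log 2 + Real.log β := by
    rw [← Real.log_mul (by norm_num) hβ0.ne']
    exact Real.log_le_log (by linarith) (by linarith)
  have hl1β0 : 0 ≤ Real.log (1 + β) := Real.log_nonneg (by linarith)
  have hlc : Real.log c ≤ 0 := Real.log_nonpos hc0.le hc1
  have hll : Real.log (1 - lam) ≤ 0 := Real.log_nonpos h1l.le (by linarith)
  have hn1 : (1 : ℝ) ≤ n := by exact_mod_cast hn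
  rw [one_div, inv_mul_le_iff₀ hn3]
  -- reduce to a polynomial inequality in `n` with the sign facts
  have hn2 : (n : ℝ) ^ 2 ≤ (n : ℝ) ^ 3 := pow_le_pow_right₀ hn1 (by norm_num)
  have hn1' : (n : ℝ) ≤ (n : ℝ) ^ 3 := by
    have h := pow_le_pow_right₀ hn1 (show 1 ≤ 3 by norm_num)
    rwa [pow_one] at h
  have key : (2 * (n : ℝ) ^ 3 - (n : ℝ) ^ 2 - n) * (3 * Real.log 2 - 3 / 2 * (Real.log (1 - lam) + Real.log β)) -
      (-(144 * (n : ℝ) ^ 3) + (2 * (n : ℝ) ^ 3 + 1) * (Real.log c - 3 / 2 * Real.log (1 + β))) ≤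
      (n : ℝ) ^ 3 * (11 * Real.log 2 + 144 - 3 * Real.log c + 3 * -Real.log (1 - lam)) +
        3 * ((n : ℝ) ^ 2 + n + 1) / 2 * Real.log β := by
    have p1 : 0 ≤ (2 * (n : ℝ) ^ 3 + 3 * (n : ℝ) ^ 2 + 3 * n - 3 / 2) * Real.log 2 :=
      mul_nonneg (by linarith [sq_nonneg (n : ℝ)]) hl2
    have p2 : 0 ≤ (3 / 2 * (n : ℝ) ^ 2 + 3 / 2 * n) * (-Real.log (1 - lam)) :=
      mul_nonneg (by positivity) (neg_nonneg.2 hll)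
    have p3 : 0 ≤ ((n : ℝ) ^ 3 - 1) * (-Real.log c) :=
      mul_nonneg (by linarith) (neg_nonneg.2 hlc)
    have p4 : (3 / 2 * (2 * (n : ℝ) ^ 3 + 1)) * Real.log (1 + β) ≤
        (3 / 2 * (2 * (n : ℝ) ^ 3 + 1)) * (Real.log 2 + Real.log β) :=
      mul_le_mul_of_nonneg_left hl1β (by positivity)
    linarith [p1, p2, p3, p4]
  calc _ ≤ (n : ℝ) ^ 3 * (11 * Real.log 2 + 144 - 3 * Real.log c + 3 * -Real.log (1 - lam)) +
        3 * ((n : ℝ) ^ 2 + n + 1) / 2 * Real.log β := key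
    _ = (n : ℝ) ^ 3 * (11 * Real.log 2 + 144 - 3 * Real.log c + 3 * -Real.log (1 - lam) +
        3 * ((n : ℝ) ^ 2 + n + 1) / (2 * (n : ℝ) ^ 3) * Real.log β) := by
        field_simp

/-- **THE RESIDUAL EXPONENT**: `3(n²+n+1)∕(2n³) ≤ 9∕(2n)` for `n ≥ 1`. [folklore] -/
theorem exponent_le {n : ℕ} (hn : 1 ≤ n) :
    3 * ((n : ℝ) ^ 2 + n + 1) / (2 * (n : ℝ) ^ 3) ≤ 9 / (2 * (n : ℝ)) := by
  have hn1 : (1 : ℝ) ≤ n := by exact_mod_cast hn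
  have hn0 : (0 : ℝ) < n := by linarith
  rw [div_le_div_iff₀ (by positivity) (by positivity)]
  have h1 : (n : ℝ) ≤ (n : ℝ) ^ 2 := by nlinarith
  have h2 : (1 : ℝ) ≤ (n : ℝ) ^ 2 := by nlinarith
  nlinarith [h1, h2, hn0]

/-- **THE SANDWICH RATIO, exponentiated**: under the hypotheses of `sandwich_log_le`,
`(zup ∕ zlow)^{1∕n³} ≤ (2048·e^{144}∕c³) · ((1−λ)⁻¹)³ · β^{3(n²+n+1)∕(2n³)}`. [folklore] -/
theorem sandwich_ratio_rpow_le {n : ℕ} (hn : 1 ≤ n) {c lam β : ℝ} (hc0 : 0 < c) (hc1 : c ≤ 1) (hlam0 : 0 ≤ lam)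
    (hlam1 : lam < 1) (hβ : 1 ≤ (1 - lam) * β) :
    ((8 / (((1 - lam) * β) * Real.sqrt ((1 - lam) * β))) ^ (2 * n ^ 3 - n ^ 2 - n) /
        (Real.exp (-(8 * (2 : ℝ) * 3 ^ 2 * (n : ℝ) ^ 3)) * (c * (Real.sqrt (1 + β))⁻¹ ^ 3) ^ (2 * n ^ 3 + 1))) ^
        ((1 : ℝ) / (n : ℝ) ^ 3) ≤
      (2048 * Real.exp 144 / c ^ 3) * ((1 - lam)⁻¹) ^ 3 * β ^ (3 * ((n : ℝ) ^ 2 + n + 1) / (2 * (n : ℝ) ^ 3)) := by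
  have h1l : 0 < 1 - lam := by linarith
  have hβ'0 : 0 < (1 - lam) * β := by linarith
  have hβ0 : 0 < β := (mul_pos_iff_of_pos_left h1l).1 hβ'0
  set zup : ℝ := (8 / (((1 - lam) * β) * Real.sqrt ((1 - lam) * β))) ^ (2 * n ^ 3 - n ^ 2 - n) with hzup
  set zlow : ℝ := Real.exp (-(8 * (2 : ℝ) * 3 ^ 2 * (n : ℝ) ^ 3)) * (c * (Real.sqrt (1 + β))⁻¹ ^ 3) ^ (2 * n ^ 3 + 1)
    with hzlow
  have hzup0 : 0 < zup := by positivity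
  have hzlow0 : 0 < zlow := by positivity
  have hK : 0 < 2048 * Real.exp 144 / c ^ 3 := by positivity
  rw [Real.rpow_def_of_pos (div_pos hzup0 hzlow0), Real.log_div hzup0.ne' hzlow0.ne', mul_comm]
  have h := sandwich_log_le hn hc0 hc1 hlam0 hlam1 hβ
  refine (Real.exp_le_exp.2 h).trans (le_of_eq ?_)
  rw [Real.exp_add, Real.exp_add, Real.exp_log hK, show (3 : ℝ) * Real.log (1 - lam)⁻¹ = ((3 : ℕ) : ℝ) * Real.log (1 - lam)⁻¹
    by norm_num, ← Real.log_pow, Real.exp_log (by positivity), Real.rpow_def_of_pos hβ0, mul_comm (Real.log β)]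

/-! ## §2 The assembled exponential moment and tail -/

/-- ★★★ **(EM) — THE PREFACTOR-FREE SINGLE-PLAQUETTE EXPONENTIAL MOMENT OF `SU(2)` ON `(ℤ∕nℤ)³`.**  There is `C > 0` such that for
every even `n ≥ 2`, `0 ≤ λ < 1`, `(1 − λ)β ≥ 1`, every direction `0 < a` and site `c₀`:
`∫ exp(λβ(2 − Re tr U_{(c₀;0,a)})) dμ_{Λ,β} ≤ C · ((1−λ)⁻¹)³ · β^{3(n²+n+1)∕(2n³)}`
(`ρ := fundamentalRep (Fin 2)`; door ✓p680874 ∘ upper ✓p681391∕✓p681608∕✓p681953 ∘ lower ✓p682361∕✓p683057 ∘ §1).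
[cite: Chatterjee2016, Thm. 2.1; FrohlichIsraelLiebSimon1978, Thm. 4.1] -/
theorem exists_integral_exp_mul_plaquette_su2_le :
    ∃ C : ℝ, 0 < C ∧ ∀ (n : ℕ) [NeZero n], 1 < n → Even n → ∀ (β lam : ℝ), 0 ≤ lam → lam < 1 → 1 ≤ (1 - lam) * β →
      ∀ (a : Fin 3), (0 : Fin 3) < a → ∀ (c₀ : Site 3 n),
        ∫ U, Real.exp (lam * β * (((2 : ℕ) : ℝ) - ((fundamentalRep (Fin 2)) (plaquetteHolonomy U c₀ 0 a)).trace.re))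
            ∂(wilsonMeasure (fundamentalRep (Fin 2)) β) ≤
          C * ((1 - lam)⁻¹) ^ 3 * β ^ (3 * ((n : ℝ) ^ 2 + n + 1) / (2 * (n : ℝ) ^ 3)) := by
  obtain ⟨c, hc0, hc1, hlow⟩ := exists_lintegral_boltzmann_ge_treeGauge_SU (d := 3) (N := 2)
  refine ⟨2048 * Real.exp 144 / c ^ 3, by positivity, ?_⟩
  intro n _ hn hne β lam hlam0 hlam1 hβ a ha c₀
  haveI : Fact (1 < n) := ⟨hn⟩
  have h1l : 0 < 1 - lam := by linarith
  have hβ'0 : 0 < (1 - lam) * β := by linarith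
  have hβ0 : 0 < β := (mul_pos_iff_of_pos_left h1l).1 hβ'0
  -- the lower bound at `d = 3`, `N = 2`
  have hZ := hlow n β hβ0.le
  have e : Real.exp (-(8 * ((2 : ℕ) : ℝ) * (3 : ℕ) ^ 2 * (n : ℝ) ^ (3 : ℕ))) *
      (c * (Real.sqrt (1 + β))⁻¹ ^ (2 ^ 2 - 1)) ^ ((3 - 1) * n ^ 3 + 1) =
      Real.exp (-(8 * (2 : ℝ) * 3 ^ 2 * (n : ℝ) ^ 3)) * (c * (Real.sqrt (1 + β))⁻¹ ^ 3) ^ (2 * n ^ 3 + 1) := by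
    norm_num
  rw [e] at hZ
  have hzlow : 0 < Real.exp (-(8 * (2 : ℝ) * 3 ^ 2 * (n : ℝ) ^ 3)) * (c * (Real.sqrt (1 + β))⁻¹ ^ 3) ^ (2 * n ^ 3 + 1) := by
    positivity
  refine (integral_exp_mul_plaquette_su2_le_of_lowerBound hn hne hβ0.le hlam0 hβ hzlow hZ ha c₀).trans ?_
  exact sandwich_ratio_rpow_le (le_of_lt hn) hc0 hc1 hlam0 hlam1 hβ

/-- ★★ **(GT) — THE PREFACTOR-FREE SINGLE-PLAQUETTE TAIL OF `SU(2)` ON `(ℤ∕nℤ)³`.**  With the same `C`: for every even `n ≥ 2`,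
`0 ≤ λ < 1`, `(1 − λ)β ≥ 1`, `0 < a`, `c₀` and `θ ≥ 0`,
`μ_{Λ,β}{θ ≤ ‖U_{(c₀;0,a)} − 1‖} ≤ C · ((1−λ)⁻¹)³ · β^{3(n²+n+1)∕(2n³)} · e^{−λβθ²∕2}` — versus ✓`gibbsMeasure_real_dist1_ge_le`'s `(√β)⁹`.
[cite: Chatterjee2016, Thm. 2.1; Gross1983, Thm. 3.6 (3.10) p.146] -/
theorem exists_measureReal_largePlaquette_su2_le :
    ∃ C : ℝ, 0 < C ∧ ∀ (n : ℕ) [NeZero n], 1 < n → Even n → ∀ (β lam : ℝ), 0 ≤ lam → lam < 1 → 1 ≤ (1 - lam) * β →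
      ∀ (a : Fin 3), (0 : Fin 3) < a → ∀ (c₀ : Site 3 n) (θ : ℝ), 0 ≤ θ →
        (wilsonMeasure (fundamentalRep (Fin 2)) β).real
            {U : GaugeConfig 3 n (Matrix.specialUnitaryGroup (Fin 2) ℂ) |
              θ ≤ ‖(fundamentalRep (Fin 2)) (plaquetteHolonomy U c₀ 0 a) - 1‖} ≤
          C * ((1 - lam)⁻¹) ^ 3 * β ^ (3 * ((n : ℝ) ^ 2 + n + 1) / (2 * (n : ℝ) ^ 3)) *
            Real.exp (-(lam * β * θ ^ 2 / 2)) := by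
  obtain ⟨c, hc0, hc1, hlow⟩ := exists_lintegral_boltzmann_ge_treeGauge_SU (d := 3) (N := 2)
  refine ⟨2048 * Real.exp 144 / c ^ 3, by positivity, ?_⟩
  intro n _ hn hne β lam hlam0 hlam1 hβ a ha c₀ θ hθ
  haveI : Fact (1 < n) := ⟨hn⟩
  have h1l : 0 < 1 - lam := by linarith
  have hβ'0 : 0 < (1 - lam) * β := by linarith
  have hβ0 : 0 < β := (mul_pos_iff_of_pos_left h1l).1 hβ'0
  have hZ := hlow n β hβ0.le
  have e : Real.exp (-(8 * ((2 : ℕ) : ℝ) * (3 : ℕ) ^ 2 * (n : ℝ) ^ (3 : ℕ))) *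
      (c * (Real.sqrt (1 + β))⁻¹ ^ (2 ^ 2 - 1)) ^ ((3 - 1) * n ^ 3 + 1) =
      Real.exp (-(8 * (2 : ℝ) * 3 ^ 2 * (n : ℝ) ^ 3)) * (c * (Real.sqrt (1 + β))⁻¹ ^ 3) ^ (2 * n ^ 3 + 1) := by
    norm_num
  rw [e] at hZ
  have hzlow : 0 < Real.exp (-(8 * (2 : ℝ) * 3 ^ 2 * (n : ℝ) ^ 3)) * (c * (Real.sqrt (1 + β))⁻¹ ^ 3) ^ (2 * n ^ 3 + 1) := by
    positivity
  refine (measureReal_largePlaquette_su2_le_of_lowerBound hn hne hβ0.le hlam0 hβ hzlow hZ ha c₀ hθ).trans ?_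
  exact mul_le_mul_of_nonneg_right (sandwich_ratio_rpow_le (le_of_lt hn) hc0 hc1 hlam0 hlam1 hβ) (Real.exp_pos _).le

end

end Summit.QuantumFields.YangMills.Theorems.LocalInsertion.ExpMomentSU2
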